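import Summits.SmoothPoincare4.SmoothPoincare4.Theses.WeylBudget
import Literature.Topology.FourManifolds.CorkDecompositionInvolutive
import HarnessLib

/-!
# Stub `stub_corkPresentation` of line `birth` for the crux `CorkRegluablePsc` — conditional form
(item stmt-SmoothPoincare4-3206, route `WeylBudget`; `--supports` helper, does not close the item)

The registered stub (skeleton `Cruxes/CorkRegluablePsc/Lines/birth.lean`) is the TOPOLOGICAL leaf
of the line: every homotopy 4-sphere `Σ` is a cork twist of the standard `S⁴` by an INVOLUTION,
`S⁴ = C ∪_φ W`, `Σ = C ∪_{φ ∘ τ} W` with `C` compact contractible, `W` compact (smooth 4-manifolds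
with boundary, Hausdorff, second countable), `φ : ∂C ≅ ∂W` and `τ : ∂C ≅ ∂C` with `τ ∘ τ = id`
(`Literature.Topology.FourManifolds.IsBoundaryGluing`).  Minus the clause `Function.Involutive τ`
this is verbatim the conclusion of the tree's proved packaging
`Literature.Topology.FourManifolds.HomotopySphere.exists_corkPresentation_of_facts`, which rests on
two UNPROVED named facts of the tree: `Θ₄ = 0`
(`Literature.Topology.FourManifolds.isHCobordant_sphere_of_homotopySphere_four`, Kervaire–Milnor
1963) and the cork decomposition theorem in Matveyev's two-piece form
(`Literature.Topology.FourManifolds.Matveyev1996_decomposition`), whose docstring records that the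
refinement "`τ = ∂g` an involution" (Kirby 1996, Addendum (D); Akbulut–Matveyev 1998) is NOT part of
it.  The hypothesis-free stub therefore cannot be closed here (it would mean formalising `Θ₄ = 0`
and the cork theorem); this file lands its CONDITIONAL form `stub_corkPresentation_of_facts`:
the registered signature, GIVEN

* `Θ₄ = 0` (`Literature.Topology.FourManifolds.isHCobordant_sphere_of_homotopySphere_four`), and
* the **cork theorem with involution**, the tree's named fact
  `Literature.Topology.FourManifolds.matveyev1996_involutiveDecomposition`
  (`CorkDecompositionInvolutive.lean`, stated for this stub and relocated there by the gate): for
  h-cobordant simply connected closed smooth 4-manifolds `X₁`, `X₂` there are a compact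
  contractible smooth `C`, a compact smooth exterior `W`, boundary data `bC`, `bW`, an involution
  `τ` of `∂C` and `φ : ∂C ≅ ∂W` with `X₁ = C ∪_φ W` and `X₂ = C ∪_{φ ∘ τ} W` — Kirby, Turkish J.
  Math. 20 (1996), arXiv:math/9712231 p. 1, Theorem with Addendum (D) ("`A₀` is diffeomorphic to
  `A₁` by a diffeomorphism which, restricted to `∂A₀ = ∂A₁`, is an involution [mat95]");
  Matveyev, J. Differential Geom. 44 (1996), Theorem (parts 1–2); Curtis–Freedman–Hsiang–Stong
  1996, Theorem; Akbulut–Yasui 2008, Thm. 1.1 ("one is obtained from the other by removing a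
  contractible 4-manifold and gluing it via an involution on the boundary").

Proof: `Σ` is simply connected (`π₁(S⁴) = 1`, `simplyConnectedSpace_sphere_four_holds`,
transported along `Σ ≃ₕ S⁴` by Mathlib's `ContinuousMap.HomotopyEquiv.simplyConnectedSpace`) and
h-cobordant to `S⁴` (`Θ₄ = 0`, symmetrised by `IsHCobordant.symm`), so the fact applied to the pair
`(S⁴, Σ)` gives the presentation, which is repackaged in the stub's binder order.  This is Kirby's
Corollary (loc. cit. p. 1: "Any homotopy 4-sphere `Σ⁴` can be constructed by cutting out a
contractible 4-manifold `A₀` from `S⁴` and gluing it back in by an involution of `∂A₀`") with the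
compact smooth exterior recorded — exactly as `HomotopySphere.exists_corkPresentation_of_facts`
does it for the non-involutive form.

No theorem named `stub_corkPresentation` is declared: the hypothesis-free signature is not proved
(trust base of the conditional form: the two named facts above).  No `sorry`; axioms standard.

References: [KirbyCorks1996] Theorem, Addendum (D), Corollary (p. 1); [Matveyev1996] Theorem
(parts 1–2); [CurtisFreedmanHsiangStong1996] Theorem; [AkbulutYasui2008] Thm. 1.1;
[AkbulutMatveyev1998]; [KervaireMilnorAnnals1963] table p. 504 (`Θ₄ = 0`); [HatcherAT2002]
Prop. 1.14.
-/

-- `Summit.<Summit>.<Problem>`: for the single-conjunct summit the duplicate component is mandated.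
set_option linter.dupNamespace false

noncomputable section

open scoped Manifold ContDiff Topology

namespace Summit.SmoothPoincare4.SmoothPoincare4.Theorems

/-- **Stub `stub_corkPresentation`, conditional form** (the registered signature of line `birth`
of the crux `CorkRegluablePsc`, GIVEN `Θ₄ = 0` and the cork theorem with involution).  Assuming
`Literature.Topology.FourManifolds.isHCobordant_sphere_of_homotopySphere_four` (Kervaire–Milnor
1963, `Θ₄ = 0`) and `Literature.Topology.FourManifolds.matveyev1996_involutiveDecomposition`
(Kirby 1996, Theorem with Addendum (D); Matveyev 1996; Akbulut–Yasui 2008, Thm. 1.1): for every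
homotopy 4-sphere `Σ` there are a compact contractible smooth `C⁴` with boundary datum `bC`, a
compact smooth `W⁴` with boundary datum `bW` (both Hausdorff, second countable), `φ : ∂C ≅ ∂W`
and an INVOLUTION `τ : ∂C ≅ ∂C` with `S⁴ = C ∪_φ W` and `Σ = C ∪_{φ ∘ τ} W`.  Proof: `Σ` is
simply connected (`π₁(S⁴) = 1` transported along `Σ ≃ₕ S⁴`) and h-cobordant to `S⁴` (`Θ₄ = 0`,
symmetrised), so the fact applied to `(S⁴, Σ)` gives the presentation; repackage.  This is
Kirby's Corollary ("Any homotopy 4-sphere `Σ⁴` can be constructed by cutting out a contractible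
4-manifold `A₀` from `S⁴` and gluing it back in by an involution of `∂A₀`") with the compact
smooth exterior recorded.
[cite: KirbyCorks1996, Corollary p. 1, from Theorem and Addendum (D)]
[cite: KervaireMilnorAnnals1963, table p. 504 (Θ₄ = 0)] [cite: Matveyev1996, Theorem] -/
theorem stub_corkPresentation_of_facts :
    Literature.Topology.FourManifolds.isHCobordant_sphere_of_homotopySphere_four →
    Literature.Topology.FourManifolds.matveyev1996_involutiveDecomposition →
    ∀ S : Literature.Topology.FourManifolds.HomotopySphere 4, ∃ (C : Type) (_ : TopologicalSpace C) (_ : T2Space C)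
    (_ : SecondCountableTopology C) (_ : ChartedSpace (EuclideanHalfSpace 4) C)
    (_ : IsManifold (𝓡∂ 4) ∞ C) (_ : CompactSpace C) (_ : ContractibleSpace C)
    (bC : Literature.Topology.FourManifolds.BoundaryData (𝓡∂ 4) C (𝓡 3))
    (W : Type) (_ : TopologicalSpace W) (_ : T2Space W) (_ : SecondCountableTopology W)
    (_ : ChartedSpace (EuclideanHalfSpace 4) W) (_ : IsManifold (𝓡∂ 4) ∞ W) (_ : CompactSpace W)
    (bW : Literature.Topology.FourManifolds.BoundaryData (𝓡∂ 4) W (𝓡 3))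
    (φ : bC.carrier ≃ₘ⟮𝓡 3, 𝓡 3⟯ bW.carrier) (τ : bC.carrier ≃ₘ⟮𝓡 3, 𝓡 3⟯ bC.carrier),
    Function.Involutive τ ∧
    Literature.Topology.FourManifolds.IsBoundaryGluing bC bW φ (𝓡 4) (Metric.sphere (0 : EuclideanSpace ℝ (Fin 5)) 1) ∧
    Literature.Topology.FourManifolds.IsBoundaryGluing bC bW (τ.trans φ) (𝓡 4) S.carrier := by
  intro hΘ hT S
  obtain ⟨e⟩ := S.nonempty_homotopyEquiv
  haveI : SimplyConnectedSpace (Metric.sphere (0 : EuclideanSpace ℝ (Fin 5)) 1) :=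
    Literature.Topology.FourManifolds.simplyConnectedSpace_sphere_four_holds
  haveI : SimplyConnectedSpace S.carrier := e.simplyConnectedSpace
  have hcob : Literature.Topology.FourManifolds.IsHCobordant 4
      (Metric.sphere (0 : EuclideanSpace ℝ (Fin 5)) 1) S.carrier :=
    (hΘ S).symm
  obtain ⟨C, _, _, _, _, _, hc, hk, W, _, _, _, _, _, hcW, bC, bW, τ, φ, hτ, hX₁, hX₂⟩ :=
    hT (Metric.sphere (0 : EuclideanSpace ℝ (Fin 5)) 1) S.carrier hcob
  exact ⟨C, ‹_›, ‹_›, ‹_›, ‹_›, ‹_›, hc, hk, bC, W, ‹_›, ‹_›, ‹_›, ‹_›, ‹_›, hcW, bW, φ, τ, hτ,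
    hX₁, hX₂⟩

end Summit.SmoothPoincare4.SmoothPoincare4.Theorems

end
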